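import Literature.AlgebraicGeometry.Hironaka2017.Lib.IrreducibleCentrePieces
import Literature.AlgebraicGeometry.Resolution.MonomialMarkedIdealsBlowupGeneral
import Literature.AlgebraicGeometry.Resolution.MarkedIdealsLemmas
import HarnessLib

/-!
# Crux `PatchingRelPerfect` (stmt-ResolutionOfSingularities-16161), chain W5.2 — TargetsF5J T5-E
# «W₂B-maxweight», the transform law of a HOST × BOUNDARY-MONOMIAL ideal along ONE irreducible centre piece

[OURS · L1 W5.2 · TargetsF5J T5-E support] Fact-free bookkeeping; NOT statements of the manuscript under review.
The E-side state of the mixed engine is `𝔟 = 𝓗 · Π_B 𝓘(B)^{c_B}` — an effective Cartier HOST `𝓗` (the strict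
transform of `Supp 𝔟₀` with multiplicities) times a monomial in the boundary `ℬ` (`monomialIdeal`, exponent list
`E`, `boundaryOf E = ℬ`). Blowing up ONE irreducible piece `D` of a CJS centre (`C = 𝓘(D)`, generic point `η`) with
weight `ν`, where the host picks up the exceptional divisor `G = C𝒪` with its generic order `m` along `D`
(`𝓗𝒪 = 𝓘(G)^m · 𝓗'`, res-D-pv-026's (L-A) `IsBlowup.comap_eq_pow_mul_controlledTransform_of_le_pow`, taken here as a
HYPOTHESIS) and the monomial picks up `𝓘(G)^{w}`, `w = weightAt E η = Σ_{B ∋ η} c_B` (tree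
`comap_monomialIdeal_pieces` along the single uniform piece `[V(C)]`, `uniformPieces_single_of_isGenericPoint`), one
gets the new state `𝔟𝒪 = 𝓘(G)^ν · (𝓗' · Π_B 𝓘(B')^{c_B} · 𝓘(G)^{m + w − ν})` — the exponent list `stepExp` = strict
transforms with the old exponents followed by the exceptional divisor with exponent `m + w − ν`, whose boundary is
EXACTLY the list law `ℬ.map (strictTransformIdeal τ C) ++ [C𝒪]` of `IsWeightedSeqJ`:

* `stepExp E τ C e`, `boundaryOf_stepExp`, `monomialIdeal_stepExp`;
* `comap_monomialIdeal_single` — `(Π 𝓘(B)^{c_B})𝒪 = 𝓘(G)^{weightAt E η} · Π 𝓘(B')^{c_B}` along `C = 𝓘(D)`;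
* `comap_host_mul_monomialIdeal` — THE LAW `(𝓗 · Π 𝓘(B)^{c_B})𝒪 = 𝓘(G)^ν · (𝓗' · monomialIdeal (stepExp …))` for
  `ν ≤ m + weightAt E η`;
* `le_add_weightAt_of_le_two` — the inequality `ν ≤ m + w` for the max-weight `ν ≤ 2` (`m ≥ 1`; if `ν = 2` and `w = 0`
  then `𝔟_η = 𝓗_η` has order `m ≥ 2`).

AI-written; AI review is weaker than expert review.

## References
* J. Kollár, *Lectures on Resolution of Singularities* (2007), (3.111) Steps 1–3. [Kollar2007]
* E. Bierstone, D. Grigoriev, P. Milman, J. Włodarczyk, arXiv:1206.3090, §3.2 Lemma 3.2.1, §4 Step 2a, Def. 3.1.3 (4).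
  [BierstoneGrigorievMilmanWlodarczyk2011]
-/

-- `Summit.<Summit>.<Sub>.Theorems` with `Sub = Summit` (single-conjunct summit, D-0017)
set_option linter.dupNamespace false

noncomputable section

open CategoryTheory CategoryTheory.Limits AlgebraicGeometry TopologicalSpace IsLocalRing
open Literature.AlgebraicGeometry.Resolution Scheme.IdealSheafData
open Literature.AlgebraicGeometry.Hironaka2017.MonomialPart Literature.AlgebraicGeometry.Hironaka2017.MonomialComponent

namespace Summit.ResolutionOfSingularities.ResolutionOfSingularities.Theorems

universe u

namespace WeightTwoB

variable {W W' : Scheme.{u}}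

/-! ## §1 The exponent list after one piece-step -/

/-- [OURS · L1 W5.2] **The exponent list after blowing up one centre piece**: the strict transforms of the old boundary
members with their exponents, followed by the exceptional divisor `C𝒪` with exponent `e`.
[cite: Kollar2007, (3.111) Steps 1–3] -/
def stepExp (E : List (W.IdealSheafData × ℕ)) (τ : W' ⟶ W) (C : W.IdealSheafData) (e : ℕ) :
    List (W'.IdealSheafData × ℕ) :=
  E.map (fun p => (strictTransformIdeal τ C p.1, p.2)) ++ [(C.comap τ, e)]

/-- Its boundary is the list law of `IsWeightedSeqJ`: `ℬ.map (strictTransformIdeal τ C) ++ [C𝒪]`. [folklore] -/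
theorem boundaryOf_stepExp (E : List (W.IdealSheafData × ℕ)) (τ : W' ⟶ W) (C : W.IdealSheafData) (e : ℕ) :
    boundaryOf (stepExp E τ C e) = (boundaryOf E).map (strictTransformIdeal τ C) ++ [C.comap τ] := by
  simp [stepExp, boundaryOf, List.map_map, Function.comp_def]

/-- Its monomial ideal: `Π 𝓘(B')^{c_B} · (C𝒪)^e`. [folklore] -/
theorem monomialIdeal_stepExp (E : List (W.IdealSheafData × ℕ)) (τ : W' ⟶ W) (C : W.IdealSheafData) (e : ℕ) :
    monomialIdeal (stepExp E τ C e) =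
      monomialIdeal (E.map fun p => (strictTransformIdeal τ C p.1, p.2)) * C.comap τ ^ e := by
  rw [stepExp, monomialIdeal_append, monomialIdeal_singleton]

/-- Every exponent-carrying member of `stepExp` is a member of the new boundary list. [folklore] -/
theorem fst_mem_boundary_of_mem_stepExp {E : List (W.IdealSheafData × ℕ)} {τ : W' ⟶ W} {C : W.IdealSheafData}
    {e : ℕ} {p : W'.IdealSheafData × ℕ} (hp : p ∈ stepExp E τ C e) :
    p.1 ∈ (boundaryOf E).map (strictTransformIdeal τ C) ++ [C.comap τ] := by
  rw [← boundaryOf_stepExp E τ C e]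
  exact fst_mem_boundaryOf hp

/-! ## §2 The transform law along one irreducible piece -/

variable [IsLocallyNoetherian W] {D : Closeds W} {η : W} {τ : W' ⟶ W} {E : List (W.IdealSheafData × ℕ)}

/-- **The monomial along ONE irreducible piece**: for `C = 𝓘(D)` with `D = cl{η}` irreducible, a boundary `E` having
simple normal crossings with `C`, and a blow-up `τ` along `C`:
`(Π_B 𝓘(B)^{c_B})𝒪 = (C𝒪)^{weightAt E η} · Π_B 𝓘(B')^{c_B}` (tree `comap_monomialIdeal_pieces` on the single uniform
piece `[V(C)]`). [cite: Kollar2007, (3.111) Step 1] [cite: BierstoneGrigorievMilmanWlodarczyk2011, §4 Step 2a] -/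
theorem comap_monomialIdeal_single (hη : IsGenericPoint η (D : Set W))
    (hEC : HasSNCWith (boundaryOf E) (vanishingIdeal D)) (hτ : IsBlowup τ (vanishingIdeal D)) :
    (monomialIdeal E).comap τ =
      (vanishingIdeal D).comap τ ^ weightAt E η *
        monomialIdeal (E.map fun p => (strictTransformIdeal τ (vanishingIdeal D) p.1, p.2)) := by
  have h := comap_monomialIdeal_pieces hEC hτ (isPiecePartition_single _) (uniformPieces_single_of_isGenericPoint E hη)
  rw [List.map_singleton, List.prod_singleton, weightOf_divisorsOver_single_eq_weightAt E hη] at h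
  have hG : exceptionalPiece τ (vanishingIdeal D).support = (vanishingIdeal D).comap τ := by
    have h2 := prod_exceptionalPiece_eq (E := E) hEC hτ (isPiecePartition_single _)
    rwa [List.map_singleton, List.prod_singleton] at h2
  rwa [hG] at h

/-- **THE TRANSFORM LAW of the host × boundary-monomial state along one irreducible piece.** With `C = 𝓘(D)`,
`D = cl{η}`, `E` snc with `C`, `τ` a blow-up along `C`, a host transform law `𝓗𝒪 = (C𝒪)^m · 𝓗'` and a weight
`ν ≤ m + weightAt E η`: `(𝓗 · Π 𝓘(B)^{c_B})𝒪 = (C𝒪)^ν · (𝓗' · monomialIdeal (stepExp E τ C (m + weightAt E η − ν)))`.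
[cite: Kollar2007, (3.111) Steps 1–3] [cite: BierstoneGrigorievMilmanWlodarczyk2011, §3.2 Lemma 3.2.1] -/
theorem comap_host_mul_monomialIdeal (hη : IsGenericPoint η (D : Set W))
    (hEC : HasSNCWith (boundaryOf E) (vanishingIdeal D)) (hτ : IsBlowup τ (vanishingIdeal D))
    {𝓗 : W.IdealSheafData} {𝓗' : W'.IdealSheafData} {m : ℕ}
    (hhost : 𝓗.comap τ = (vanishingIdeal D).comap τ ^ m * 𝓗') {ν : ℕ} (hν : ν ≤ m + weightAt E η) :
    (𝓗 * monomialIdeal E).comap τ =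
      (vanishingIdeal D).comap τ ^ ν *
        (𝓗' * monomialIdeal (stepExp E τ (vanishingIdeal D) (m + weightAt E η - ν))) := by
  rw [comap_mul, hhost, comap_monomialIdeal_single hη hEC hτ, monomialIdeal_stepExp]
  set G := (vanishingIdeal D).comap τ
  set M' := monomialIdeal (E.map fun p => (strictTransformIdeal τ (vanishingIdeal D) p.1, p.2))
  obtain ⟨k, hk⟩ := Nat.exists_eq_add_of_le hν
  rw [hk, Nat.add_sub_cancel_left]
  calc G ^ m * 𝓗' * (G ^ weightAt E η * M')
      = G ^ (m + weightAt E η) * (𝓗' * M') := by rw [pow_add]; ring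
    _ = G ^ (ν + k) * (𝓗' * M') := by rw [hk]
    _ = G ^ ν * (𝓗' * (M' * G ^ k)) := by rw [pow_add]; ring

/-! ## §3 The exponent inequality `ν ≤ m + w` under the max-weight cap `ν ≤ 2` -/

omit [IsLocallyNoetherian W] in
/-- **`ν ≤ m + weightAt E η`** for a weight `ν ≤ 2` admissible for `𝔟 = 𝓗 · monomialIdeal E` along `D = cl{η}`
(`ν ≤ ord_η 𝔟`), when the host passes through `η` with order `m ≥ 1` exactly and the boundary is snc: if `ν = 2`
and `w = 0` then `𝔟_η = 𝓗_η` has order `m`, so `m ≥ 2`. [folklore] -/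
theorem le_add_weightAt_of_le_two (hE : HasSNC (boundaryOf E)) {𝓗 : W.IdealSheafData} {m ν : ℕ}
    (hν2 : ν ≤ 2) (hm1 : 1 ≤ m) (hm : idealOrder 𝓗 η = m)
    (hνord : (ν : ℕ∞) ≤ idealOrder (𝓗 * monomialIdeal E) η) : ν ≤ m + weightAt E η := by
  by_contra hlt
  rw [not_le] at hlt
  -- then `w = 0`, `ν = 2`, `m = 1`
  have hw : weightAt E η = 0 := by omega
  have hν : ν = 2 := by omega
  -- `monomialIdeal E` is the unit ideal at `η`
  have hM : stalkIdeal (monomialIdeal E) η = ⊤ := by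
    by_contra hne
    have hsupp : η ∈ (monomialIdeal E).support :=
      (mem_support_iff_stalkIdeal_le _ η).mpr (le_maximalIdeal hne)
    have h1 : (1 : ℕ∞) ≤ idealOrder (monomialIdeal E) η := (one_le_idealOrder_iff _ η).mpr hsupp
    have h1' := (le_idealOrder_monomialIdeal_iff hE 1 η).mp (by exact_mod_cast h1)
    omega
  have hord : (2 : ℕ∞) ≤ idealOrder 𝓗 η := by
    have h2 : ((2 : ℕ) : ℕ∞) ≤ idealOrder (𝓗 * monomialIdeal E) η := by rw [← hν]; exact hνord
    rw [le_idealOrder_iff, stalkIdeal_mul, hM, Ideal.mul_top] at h2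
    exact_mod_cast (le_idealOrder_iff 𝓗 η 2).mpr h2
  rw [hm] at hord
  have : (2 : ℕ) ≤ m := by exact_mod_cast hord
  omega

end WeightTwoB

end Summit.ResolutionOfSingularities.ResolutionOfSingularities.Theorems

end
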